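import Mathlib.Analysis.SpecialFunctions.Log.Basic
import Mathlib.Order.Interval.Set.Basic
import Mathlib.Tactic
import HarnessLib

/-!
# ζ(5) search — growth and Casoratian of THIRD-order recurrences (cell `pub-zeta5`, TYPER)

HONEST FRAMING: systematic search; no irrationality claim unless certified.

Companion of `RecurrenceGrowth.lean` (order 2). Every known Apéry-type construction for `ζ(5)`
comes with a recurrence of ORDER THREE (Zudilin 2002,
`Literature.NumberTheory.Irrationality.Zudilin2002.IsSolution`; the Brown–Zudilin 2022 cellular
family in the totally symmetric case), so the recurrence-first certificate (FORMAT A,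
`ApproximationCertificate`) needs order-3 versions of its two finitary tools: growth of a positive
solution by a RATIO INDUCTION, and control of the CASORATIAN `W n = u n v (n+1) - u (n+1) v n` of
two solutions. Both are supplied here, Poincaré–Perron-free:

* `ratio_mem_of_recurrence3` — **invariant-set ratio induction**: for
  `u (n+3) = a n u (n+2) + b n u (n+1) + c n u n` (`n ≥ N`), if a set `S ⊆ (0, ∞)` of ratios is
  invariant under `(x, y) ↦ a n + b n / y + c n / (y x)` (`x = u (n+1)/u n`, `y = u (n+2)/u (n+1)`)
  and contains the two initial ratios, then `u n > 0` and `u (n+1)/u n ∈ S` for all `n ≥ N`;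
* `ratio_bounds_of_recurrence3_mixed` / `_pos` / `_neg` — the box `S = [λ, Λ]` for the three
  monotone sign patterns of `(b, c)`: `c ≤ 0 ≤ b λ + c` (the Zudilin-2002 shape
  `u (n+1) = A u n + B u (n-1) - C u (n-2)`, `A, B, C > 0`, after the sign flip
  `u n = (-1)^{n+1} q n`), `b, c ≥ 0`, and `b, c ≤ 0`. Invariance reduces to TWO corner
  inequalities per `n ≥ N` — polynomial inequalities in `n` after clearing denominators, certified
  by `PolyPositivity.lean` — and the conclusion `0 < u n ∧ λ u n ≤ u (n+1) ≤ Λ u n` is exactly the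
  input of `RecurrenceGrowth.eventually_exp_le_of_ratio` / `eventually_le_exp_of_ratio`
  (certificate fields `growth_lower`, `growth_upper`);
* `casoratian3_step`, `casoratian3_step'`, `casoratian3_rec` — the Casoratian of two solutions
  satisfies the explicit order-3 recurrence
  `W (n+3) = -b (n+1) W (n+2) - a n c (n+1) W (n+1) + c n c (n+1) W n`
  (the second compound of the equation; its characteristic roots are the pairwise products of the
  original ones), so the fields `casorati_le`, `casorati_ne` follow from the SAME ratio induction
  applied to `W` or `(-1)^n W`.

Everything is PROVED; no definitions, no named facts; pure sequence algebra (no `ζ` input).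
-/

noncomputable section

open Set

namespace Summit.KontsevichZagierPeriods.Zeta5Search

/-! ### Invariant-set ratio induction (order 3) -/

/-- **Ratio induction for a third-order recurrence, invariant-set form.** Let
`u (n+3) = a n · u (n+2) + b n · u (n+1) + c n · u n` for `n ≥ N`, and let `S` be a set of positive
reals with `a n + b n / y + c n / (y · x) ∈ S` whenever `x, y ∈ S` and `n ≥ N`. If `u N > 0` and
the ratios `u (N+1)/u N`, `u (N+2)/u (N+1)` lie in `S`, then for every `n ≥ N`: `u n > 0` and the
ratios `u (n+1)/u n`, `u (n+2)/u (n+1)` lie in `S`. -/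
theorem ratio_mem_of_recurrence3 (u a b c : ℕ → ℝ) (S : Set ℝ) (N : ℕ) (hS : ∀ x ∈ S, 0 < x)
    (hrec : ∀ n, N ≤ n → u (n + 3) = a n * u (n + 2) + b n * u (n + 1) + c n * u n)
    (hinv : ∀ n, N ≤ n → ∀ x ∈ S, ∀ y ∈ S, a n + b n / y + c n / (y * x) ∈ S)
    (h0 : 0 < u N) (h1 : u (N + 1) / u N ∈ S) (h2 : u (N + 2) / u (N + 1) ∈ S) :
    ∀ n, N ≤ n → 0 < u n ∧ u (n + 1) / u n ∈ S ∧ u (n + 2) / u (n + 1) ∈ S := by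
  refine Nat.le_induction ⟨h0, h1, h2⟩ fun n hn ih => ?_
  obtain ⟨hpos, hr0, hr1⟩ := ih
  have hx : 0 < u (n + 1) / u n := hS _ hr0
  have hpos1 : 0 < u (n + 1) := by
    have := mul_pos hx hpos; rwa [div_mul_cancel₀ _ hpos.ne'] at this
  have hy : 0 < u (n + 2) / u (n + 1) := hS _ hr1
  have hpos2 : 0 < u (n + 2) := by
    have := mul_pos hy hpos1; rwa [div_mul_cancel₀ _ hpos1.ne'] at this
  refine ⟨hpos1, hr1, ?_⟩
  have key : u (n + 3) / u (n + 2) =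
      a n + b n / (u (n + 2) / u (n + 1)) + c n / (u (n + 2) / u (n + 1) * (u (n + 1) / u n)) := by
    rw [hrec n hn]
    field_simp
  rw [show n + 1 + 2 = n + 3 by ring, show n + 1 + 1 = n + 2 by ring, key]
  exact hinv n hn _ hr0 _ hr1

/-- From ratio membership in a box to the certificate shape: if `u n > 0` and
`u (n+1)/u n ∈ [λ, Λ]` then `λ u n ≤ u (n+1) ≤ Λ u n`. -/
theorem ratio_bounds_of_mem_Icc {u : ℕ → ℝ} {lam Lam : ℝ} {n : ℕ} (hpos : 0 < u n)
    (h : u (n + 1) / u n ∈ Icc lam Lam) : lam * u n ≤ u (n + 1) ∧ u (n + 1) ≤ Lam * u n := by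
  obtain ⟨h1, h2⟩ := h
  rw [le_div_iff₀ hpos] at h1
  rw [div_le_iff₀ hpos] at h2
  exact ⟨h1, h2⟩

/-! ### Elementary corner estimates on the box `[λ, Λ]` -/

/-- `c/x` for `c ≤ 0` is increasing on `(0, ∞)`: `λ ≤ x ≤ Λ` gives `c/λ ≤ c/x ≤ c/Λ`. -/
theorem div_bounds_of_nonpos {c lam Lam x : ℝ} (hlam : 0 < lam) (hc : c ≤ 0)
    (hx : x ∈ Icc lam Lam) : c / lam ≤ c / x ∧ c / x ≤ c / Lam := by
  obtain ⟨hx1, hx2⟩ := hx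
  have hx0 : 0 < x := hlam.trans_le hx1
  have hLam : 0 < Lam := hx0.trans_le hx2
  constructor
  · rw [div_le_div_iff₀ hlam hx0]; nlinarith
  · rw [div_le_div_iff₀ hx0 hLam]; nlinarith

/-- `c/x` for `c ≥ 0` is decreasing on `(0, ∞)`: `λ ≤ x ≤ Λ` gives `c/Λ ≤ c/x ≤ c/λ`. -/
theorem div_bounds_of_nonneg {c lam Lam x : ℝ} (hlam : 0 < lam) (hc : 0 ≤ c)
    (hx : x ∈ Icc lam Lam) : c / Lam ≤ c / x ∧ c / x ≤ c / lam := by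
  obtain ⟨hx1, hx2⟩ := hx
  have hx0 : 0 < x := hlam.trans_le hx1
  have hLam : 0 < Lam := hx0.trans_le hx2
  constructor
  · rw [div_le_div_iff₀ hLam hx0]; nlinarith
  · rw [div_le_div_iff₀ hx0 hlam]; nlinarith

/-- The map `(x, y) ↦ a + b/y + c/(y x)` written as `a + (b + c/x)/y`. -/
theorem step_map_eq {a b c x y : ℝ} (hx : x ≠ 0) (hy : y ≠ 0) :
    a + b / y + c / (y * x) = a + (b + c / x) / y := by
  field_simp
  ring

/-- **Corner bounds, mixed signs** (`c ≤ 0 ≤ b λ + c`, hence `b ≥ 0`; the Zudilin-2002 shape): for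
`x, y ∈ [λ, Λ]` (`λ > 0`),
`a + b/Λ + c/(λ Λ) ≤ a + b/y + c/(y x) ≤ a + b/λ + c/(λ Λ)`. -/
theorem corner_bounds_mixed {a b c lam Lam x y : ℝ} (hlam : 0 < lam) (hc : c ≤ 0)
    (hbc : 0 ≤ b * lam + c) (hx : x ∈ Icc lam Lam) (hy : y ∈ Icc lam Lam) :
    a + b / Lam + c / (lam * Lam) ≤ a + b / y + c / (y * x) ∧
      a + b / y + c / (y * x) ≤ a + b / lam + c / (lam * Lam) := by
  have hx0 : 0 < x := hlam.trans_le hx.1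
  have hy0 : 0 < y := hlam.trans_le hy.1
  have hLam : 0 < Lam := hx0.trans_le hx.2
  obtain ⟨hc1, hc2⟩ := div_bounds_of_nonpos hlam hc hx
  -- `φ(x) = b + c/x` satisfies `0 ≤ φ(λ) ≤ φ(x) ≤ φ(Λ)`
  have hφ0 : 0 ≤ b + c / lam := by
    have e : b + c / lam = (b * lam + c) / lam := by field_simp
    rw [e]; positivity
  have hφx : 0 ≤ b + c / x := by linarith
  obtain ⟨hd1, hd2⟩ := div_bounds_of_nonneg hlam hφx hy
  rw [step_map_eq hx0.ne' hy0.ne']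
  constructor
  · -- lower corner: `(b + c/λ)/Λ ≤ (b + c/x)/Λ ≤ (b + c/x)/y`
    have h1 : (b + c / lam) / Lam ≤ (b + c / x) / Lam :=
      div_le_div_of_nonneg_right (by linarith) hLam.le
    have e : a + b / Lam + c / (lam * Lam) = a + (b + c / lam) / Lam := by
      field_simp; ring
    rw [e]; linarith
  · -- upper corner: `(b + c/x)/y ≤ (b + c/x)/λ ≤ (b + c/Λ)/λ`
    have h1 : (b + c / x) / lam ≤ (b + c / Lam) / lam :=
      div_le_div_of_nonneg_right (by linarith) hlam.le
    have e : a + b / lam + c / (lam * Lam) = a + (b + c / Lam) / lam := by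
      field_simp; ring
    rw [e]; linarith

/-- **Corner bounds, nonnegative signs** (`b, c ≥ 0`): for `x, y ∈ [λ, Λ]` (`λ > 0`),
`a + b/Λ + c/(Λ Λ) ≤ a + b/y + c/(y x) ≤ a + b/λ + c/(λ λ)`. -/
theorem corner_bounds_pos {a b c lam Lam x y : ℝ} (hlam : 0 < lam) (hb : 0 ≤ b) (hc : 0 ≤ c)
    (hx : x ∈ Icc lam Lam) (hy : y ∈ Icc lam Lam) :
    a + b / Lam + c / (Lam * Lam) ≤ a + b / y + c / (y * x) ∧
      a + b / y + c / (y * x) ≤ a + b / lam + c / (lam * lam) := by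
  have hx0 : 0 < x := hlam.trans_le hx.1
  have hy0 : 0 < y := hlam.trans_le hy.1
  have hLam : 0 < Lam := hx0.trans_le hx.2
  obtain ⟨hc1, hc2⟩ := div_bounds_of_nonneg hlam hc hx
  have hφΛ : 0 ≤ b + c / Lam := by positivity
  have hφx : 0 ≤ b + c / x := by positivity
  obtain ⟨hd1, hd2⟩ := div_bounds_of_nonneg hlam hφx hy
  rw [step_map_eq hx0.ne' hy0.ne']
  constructor
  · have h1 : (b + c / Lam) / Lam ≤ (b + c / x) / Lam :=
      div_le_div_of_nonneg_right (by linarith) hLam.le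
    have e : a + b / Lam + c / (Lam * Lam) = a + (b + c / Lam) / Lam := by
      field_simp; ring
    rw [e]; linarith
  · have h1 : (b + c / x) / lam ≤ (b + c / lam) / lam :=
      div_le_div_of_nonneg_right (by linarith) hlam.le
    have e : a + b / lam + c / (lam * lam) = a + (b + c / lam) / lam := by
      field_simp; ring
    rw [e]; linarith

/-- **Corner bounds, nonpositive signs** (`b, c ≤ 0`): for `x, y ∈ [λ, Λ]` (`λ > 0`),
`a + b/λ + c/(λ λ) ≤ a + b/y + c/(y x) ≤ a + b/Λ + c/(Λ Λ)`. -/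
theorem corner_bounds_neg {a b c lam Lam x y : ℝ} (hlam : 0 < lam) (hb : b ≤ 0) (hc : c ≤ 0)
    (hx : x ∈ Icc lam Lam) (hy : y ∈ Icc lam Lam) :
    a + b / lam + c / (lam * lam) ≤ a + b / y + c / (y * x) ∧
      a + b / y + c / (y * x) ≤ a + b / Lam + c / (Lam * Lam) := by
  have hx0 : 0 < x := hlam.trans_le hx.1
  have hy0 : 0 < y := hlam.trans_le hy.1
  have hLam : 0 < Lam := hx0.trans_le hx.2
  obtain ⟨hc1, hc2⟩ := div_bounds_of_nonpos hlam hc hx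
  have hcΛ : c / Lam ≤ 0 := div_nonpos_of_nonpos_of_nonneg hc hLam.le
  have hφx : b + c / x ≤ 0 := by linarith
  -- for a nonpositive numerator, dividing by a larger `y` gives a larger value
  obtain ⟨hd1, hd2⟩ := div_bounds_of_nonpos hlam hφx hy
  rw [step_map_eq hx0.ne' hy0.ne']
  constructor
  · have h1 : (b + c / lam) / lam ≤ (b + c / x) / lam :=
      div_le_div_of_nonneg_right (by linarith) hlam.le
    have e : a + b / lam + c / (lam * lam) = a + (b + c / lam) / lam := by
      field_simp; ring
    rw [e]; linarith
  · have h1 : (b + c / x) / Lam ≤ (b + c / Lam) / Lam :=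
      div_le_div_of_nonneg_right (by linarith) hLam.le
    have e : a + b / Lam + c / (Lam * Lam) = a + (b + c / Lam) / Lam := by
      field_simp; ring
    rw [e]; linarith

/-! ### Ratio bounds on the box for the three sign patterns -/

/-- **Ratio induction, order 3, mixed signs** (the Zudilin-2002 / Brown–Zudilin shape). Let
`u (n+3) = a n u (n+2) + b n u (n+1) + c n u n` for `n ≥ N` with `c n ≤ 0` and
`b n · λ + c n ≥ 0` (so `b n ≥ 0`), and let `0 < λ ≤ Λ` satisfy the two corner inequalities
`λ ≤ a n + b n/Λ + c n/(λ Λ)` and `a n + b n/λ + c n/(λ Λ) ≤ Λ` for `n ≥ N`. If `u N > 0` and the two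
initial ratios lie in `[λ, Λ]`, then for every `n ≥ N`: `u n > 0` and `λ u n ≤ u (n+1) ≤ Λ u n`. -/
theorem ratio_bounds_of_recurrence3_mixed (u a b c : ℕ → ℝ) {lam Lam : ℝ} (N : ℕ)
    (hrec : ∀ n, N ≤ n → u (n + 3) = a n * u (n + 2) + b n * u (n + 1) + c n * u n)
    (hlam : 0 < lam) (hc : ∀ n, N ≤ n → c n ≤ 0) (hbc : ∀ n, N ≤ n → 0 ≤ b n * lam + c n)
    (hlow : ∀ n, N ≤ n → lam ≤ a n + b n / Lam + c n / (lam * Lam))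
    (hup : ∀ n, N ≤ n → a n + b n / lam + c n / (lam * Lam) ≤ Lam)
    (h0 : 0 < u N) (h1 : lam * u N ≤ u (N + 1)) (h1' : u (N + 1) ≤ Lam * u N)
    (h2 : lam * u (N + 1) ≤ u (N + 2)) (h2' : u (N + 2) ≤ Lam * u (N + 1)) :
    ∀ n, N ≤ n → 0 < u n ∧ lam * u n ≤ u (n + 1) ∧ u (n + 1) ≤ Lam * u n := by
  have hS : ∀ x ∈ Icc lam Lam, 0 < x := fun x hx => hlam.trans_le hx.1
  have hpos1 : 0 < u (N + 1) := (mul_pos hlam h0).trans_le h1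
  have hinv : ∀ n, N ≤ n → ∀ x ∈ Icc lam Lam, ∀ y ∈ Icc lam Lam,
      a n + b n / y + c n / (y * x) ∈ Icc lam Lam := by
    intro n hn x hx y hy
    obtain ⟨hl, hu⟩ := corner_bounds_mixed (a := a n) hlam (hc n hn) (hbc n hn) hx hy
    exact ⟨(hlow n hn).trans hl, hu.trans (hup n hn)⟩
  have hmem := ratio_mem_of_recurrence3 u a b c (Icc lam Lam) N hS hrec hinv h0
    ⟨(le_div_iff₀ h0).2 h1, (div_le_iff₀ h0).2 h1'⟩
    ⟨(le_div_iff₀ hpos1).2 h2, (div_le_iff₀ hpos1).2 h2'⟩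
  intro n hn
  obtain ⟨hpos, hr, -⟩ := hmem n hn
  exact ⟨hpos, ratio_bounds_of_mem_Icc hpos hr⟩

/-- **Ratio induction, order 3, nonnegative signs** (`b n, c n ≥ 0`): corner inequalities
`λ ≤ a n + b n/Λ + c n/(Λ Λ)` and `a n + b n/λ + c n/(λ λ) ≤ Λ` for `n ≥ N`, initial ratios in
`[λ, Λ]`, `u N > 0` ⇒ `u n > 0` and `λ u n ≤ u (n+1) ≤ Λ u n` for all `n ≥ N`. -/
theorem ratio_bounds_of_recurrence3_pos (u a b c : ℕ → ℝ) {lam Lam : ℝ} (N : ℕ)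
    (hrec : ∀ n, N ≤ n → u (n + 3) = a n * u (n + 2) + b n * u (n + 1) + c n * u n)
    (hlam : 0 < lam) (hb : ∀ n, N ≤ n → 0 ≤ b n) (hc : ∀ n, N ≤ n → 0 ≤ c n)
    (hlow : ∀ n, N ≤ n → lam ≤ a n + b n / Lam + c n / (Lam * Lam))
    (hup : ∀ n, N ≤ n → a n + b n / lam + c n / (lam * lam) ≤ Lam)
    (h0 : 0 < u N) (h1 : lam * u N ≤ u (N + 1)) (h1' : u (N + 1) ≤ Lam * u N)
    (h2 : lam * u (N + 1) ≤ u (N + 2)) (h2' : u (N + 2) ≤ Lam * u (N + 1)) :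
    ∀ n, N ≤ n → 0 < u n ∧ lam * u n ≤ u (n + 1) ∧ u (n + 1) ≤ Lam * u n := by
  have hS : ∀ x ∈ Icc lam Lam, 0 < x := fun x hx => hlam.trans_le hx.1
  have hpos1 : 0 < u (N + 1) := (mul_pos hlam h0).trans_le h1
  have hinv : ∀ n, N ≤ n → ∀ x ∈ Icc lam Lam, ∀ y ∈ Icc lam Lam,
      a n + b n / y + c n / (y * x) ∈ Icc lam Lam := by
    intro n hn x hx y hy
    obtain ⟨hl, hu⟩ := corner_bounds_pos (a := a n) hlam (hb n hn) (hc n hn) hx hy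
    exact ⟨(hlow n hn).trans hl, hu.trans (hup n hn)⟩
  have hmem := ratio_mem_of_recurrence3 u a b c (Icc lam Lam) N hS hrec hinv h0
    ⟨(le_div_iff₀ h0).2 h1, (div_le_iff₀ h0).2 h1'⟩
    ⟨(le_div_iff₀ hpos1).2 h2, (div_le_iff₀ hpos1).2 h2'⟩
  intro n hn
  obtain ⟨hpos, hr, -⟩ := hmem n hn
  exact ⟨hpos, ratio_bounds_of_mem_Icc hpos hr⟩

/-- **Ratio induction, order 3, nonpositive signs** (`b n, c n ≤ 0`): corner inequalities
`λ ≤ a n + b n/λ + c n/(λ λ)` and `a n + b n/Λ + c n/(Λ Λ) ≤ Λ` for `n ≥ N`, initial ratios in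
`[λ, Λ]`, `u N > 0` ⇒ `u n > 0` and `λ u n ≤ u (n+1) ≤ Λ u n` for all `n ≥ N`. -/
theorem ratio_bounds_of_recurrence3_neg (u a b c : ℕ → ℝ) {lam Lam : ℝ} (N : ℕ)
    (hrec : ∀ n, N ≤ n → u (n + 3) = a n * u (n + 2) + b n * u (n + 1) + c n * u n)
    (hlam : 0 < lam) (hb : ∀ n, N ≤ n → b n ≤ 0) (hc : ∀ n, N ≤ n → c n ≤ 0)
    (hlow : ∀ n, N ≤ n → lam ≤ a n + b n / lam + c n / (lam * lam))
    (hup : ∀ n, N ≤ n → a n + b n / Lam + c n / (Lam * Lam) ≤ Lam)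
    (h0 : 0 < u N) (h1 : lam * u N ≤ u (N + 1)) (h1' : u (N + 1) ≤ Lam * u N)
    (h2 : lam * u (N + 1) ≤ u (N + 2)) (h2' : u (N + 2) ≤ Lam * u (N + 1)) :
    ∀ n, N ≤ n → 0 < u n ∧ lam * u n ≤ u (n + 1) ∧ u (n + 1) ≤ Lam * u n := by
  have hS : ∀ x ∈ Icc lam Lam, 0 < x := fun x hx => hlam.trans_le hx.1
  have hpos1 : 0 < u (N + 1) := (mul_pos hlam h0).trans_le h1
  have hinv : ∀ n, N ≤ n → ∀ x ∈ Icc lam Lam, ∀ y ∈ Icc lam Lam,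
      a n + b n / y + c n / (y * x) ∈ Icc lam Lam := by
    intro n hn x hx y hy
    obtain ⟨hl, hu⟩ := corner_bounds_neg (a := a n) hlam (hb n hn) (hc n hn) hx hy
    exact ⟨(hlow n hn).trans hl, hu.trans (hup n hn)⟩
  have hmem := ratio_mem_of_recurrence3 u a b c (Icc lam Lam) N hS hrec hinv h0
    ⟨(le_div_iff₀ h0).2 h1, (div_le_iff₀ h0).2 h1'⟩
    ⟨(le_div_iff₀ hpos1).2 h2, (div_le_iff₀ hpos1).2 h2'⟩
  intro n hn
  obtain ⟨hpos, hr, -⟩ := hmem n hn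
  exact ⟨hpos, ratio_bounds_of_mem_Icc hpos hr⟩

/-! ### The Casoratian of two solutions (second compound of the recurrence) -/

/-- **Compound step, gap two.** For two solutions `u, v` of
`y (n+3) = a n y (n+2) + b n y (n+1) + c n y n`:
`u (n+1) v (n+3) - u (n+3) v (n+1) = a n · (u (n+1) v (n+2) - u (n+2) v (n+1)) - c n · (u n v (n+1) - u (n+1) v n)`. -/
theorem casoratian3_step {R : Type*} [CommRing R] (u v a b c : ℕ → R) (n : ℕ)
    (hu : u (n + 3) = a n * u (n + 2) + b n * u (n + 1) + c n * u n)
    (hv : v (n + 3) = a n * v (n + 2) + b n * v (n + 1) + c n * v n) :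
    u (n + 1) * v (n + 3) - u (n + 3) * v (n + 1) =
      a n * (u (n + 1) * v (n + 2) - u (n + 2) * v (n + 1)) -
        c n * (u n * v (n + 1) - u (n + 1) * v n) := by
  rw [hu, hv]; ring

/-- **Compound step, consecutive.** For two solutions `u, v` as above:
`u (n+2) v (n+3) - u (n+3) v (n+2) = -b n · (u (n+1) v (n+2) - u (n+2) v (n+1)) - c n · (u n v (n+2) - u (n+2) v n)`. -/
theorem casoratian3_step' {R : Type*} [CommRing R] (u v a b c : ℕ → R) (n : ℕ)
    (hu : u (n + 3) = a n * u (n + 2) + b n * u (n + 1) + c n * u n)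
    (hv : v (n + 3) = a n * v (n + 2) + b n * v (n + 1) + c n * v n) :
    u (n + 2) * v (n + 3) - u (n + 3) * v (n + 2) =
      -b n * (u (n + 1) * v (n + 2) - u (n + 2) * v (n + 1)) -
        c n * (u n * v (n + 2) - u (n + 2) * v n) := by
  rw [hu, hv]; ring

/-- **The Casoratian recurrence (order 3).** For two solutions `u, v` of
`y (n+3) = a n y (n+2) + b n y (n+1) + c n y n` (`n ≥ N`), the Casoratian
`W n = u n v (n+1) - u (n+1) v n` satisfies, for every `n ≥ N`,
`W (n+3) = -b (n+1) · W (n+2) - a n c (n+1) · W (n+1) + c n c (n+1) · W n`. -/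
theorem casoratian3_rec {R : Type*} [CommRing R] (u v a b c : ℕ → R) (N : ℕ)
    (hu : ∀ n, N ≤ n → u (n + 3) = a n * u (n + 2) + b n * u (n + 1) + c n * u n)
    (hv : ∀ n, N ≤ n → v (n + 3) = a n * v (n + 2) + b n * v (n + 1) + c n * v n) (n : ℕ)
    (hn : N ≤ n) :
    u (n + 3) * v (n + 4) - u (n + 4) * v (n + 3) =
      -b (n + 1) * (u (n + 2) * v (n + 3) - u (n + 3) * v (n + 2)) -
        a n * c (n + 1) * (u (n + 1) * v (n + 2) - u (n + 2) * v (n + 1)) +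
        c n * c (n + 1) * (u n * v (n + 1) - u (n + 1) * v n) := by
  have hn1 : N ≤ n + 1 := Nat.le_succ_of_le hn
  have e1 := casoratian3_step' u v a b c (n + 1) (hu (n + 1) hn1) (hv (n + 1) hn1)
  have e2 := casoratian3_step u v a b c n (hu n hn) (hv n hn)
  simp only [show n + 1 + 1 = n + 2 by ring, show n + 1 + 2 = n + 3 by ring,
    show n + 1 + 3 = n + 4 by ring] at e1
  rw [e1, e2]; ring

/-- **Sign flip.** If `y` solves `y (n+3) = a n y (n+2) + b n y (n+1) + c n y n` then
`z n = (-1)^n y n` solves `z (n+3) = (-a n) z (n+2) + b n z (n+1) + (-c n) z n` — the normalisation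
that makes an alternating dominant solution positive (Zudilin 2002: `q n` alternates, dominant
characteristic root `μ₃ < 0`). -/
theorem alternating_solution {R : Type*} [CommRing R] (y a b c : ℕ → R) (n : ℕ)
    (hy : y (n + 3) = a n * y (n + 2) + b n * y (n + 1) + c n * y n) :
    (-1 : R) ^ (n + 3) * y (n + 3) =
      (-a n) * ((-1 : R) ^ (n + 2) * y (n + 2)) + b n * ((-1 : R) ^ (n + 1) * y (n + 1)) +
        (-c n) * ((-1 : R) ^ n * y n) := by
  rw [hy]; ring

end Summit.KontsevichZagierPeriods.Zeta5Search
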